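import Summits.KontsevichZagierPeriods.KontsevichZagierPeriods.Theses.SymplecticScissors
import Summits.KontsevichZagierPeriods.KontsevichZagierPeriods.Theorems.TypeAGeneration.Negative.SameVariablesWitness
import Summits.KontsevichZagierPeriods.KontsevichZagierPeriods.Theorems.UnfoldedStokesStokesGenerationStubSpanToReps
import Literature.Barriers.KontsevichZagierPeriods.AlgebraicPrimitivesObstruction

/-!
# `TypeAGeneration` (stmt-KontsevichZagierPeriods-18392) — certificates in the SAME variables fail

cdisprove (refuter) negative lemma for the crux `TypeAGeneration` of route
`KontsevichZagierPeriods/SymplecticScissors` (= the conjecture leaf `TypeAGenerationConjecture`,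
Ayoub 2015 Conj. 1.1 / Fresán 2024 Conj. 3.5, typed over `AyoubPeriodSeries.lean`). Part 2 of 2
(part 1, `Negative/SameVariablesWitness.lean`: the witness `F` and the one-variable lemmas).

The natural STRENGTHENING "the certificates `G` may be taken in the same variables as `F`"
(Ayoub 2015, Rem. 1.2: "a peu de chance d'être vraie si l'on fixe le nombre de variables") is
FALSE already for one variable, INSIDE Ayoub's typed algebra:

* the kernel element `F = 1/(2 + z₀) − 1/(3 − z₀) ∈ 𝒪_{ℚ-alg}(𝔻̄¹)` (part 1, `exists_witness`: in
  `AyoubRel.Oan ℚ`, one variable, `AyoubRel.intC F = 0`; the REFLECTION relation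
  `∫₀¹ φ(z) dz = ∫₀¹ φ(1 − z) dz`, `φ = 1/(2 + z)`, one change of variables in dimension one)
* is NOT a `ℚ`-combination of type-(a) elements `∂G/∂zᵢ − G|_{zᵢ=1} + G|_{zᵢ=0}` with
  `G ∈ 𝒪_{ℚ-alg}(𝔻̄^∞)` depending on `z₀` only (`typeAGeneration_false_sameVariables`).

Proof: directions `i ≥ 1` contribute `0` for one-variable `G` (part 1); the `i = 0` combination is
carried to REAL functions by the dictionary of the sibling line (`StokesGenerationLine.generator_package`,
`cube_identity`: the real parts of the `ℚ`-algebraic series are `ℚ`-semialgebraic `C¹` germs),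
evaluated along the edge `t ↦ (t, 0, …, 0)` of the cube: `f(t) = g'(t) − (g(1) − g(0))` on `(0, 1)`
with `g` `ℚ`-semialgebraic on `[0, 1]`, i.e. `f + c` has a semialgebraic primitive — impossible by
the simple-pole descent of the barrier file
(`Literature.Barriers.KontsevichZagierPeriods.KZ.NoSemialgPrimKernel.eq_zero_of_evalEval_eq_zero`,
pole `t = 3`). So any proof of the crux must use auxiliary variables already for this `F` (two
suffice in print: Ayoub 2015 Rem. 1.5, Fresán 2024 Rem. 3.7). Theorems only.

References: Ayoub, Ann. of Math. 181 (2015), Conj. 1.1, Rem. 1.2, Rem. 1.5; Fresán, Journées X-UPS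
2024, Conj. 3.5, Rem. 3.6–3.7; Ayoub, EMS Newsl. 91 (2014), Def. 10, Rem. 13.
-/

noncomputable section

namespace Summit.KontsevichZagierPeriods.SymplecticScissors.TypeAGenerationNegative

open Set Finsupp
open Literature.NumberTheory.Transcendental
open Literature.NumberTheory.Transcendental.AyoubRel
open Summit.KontsevichZagierPeriods.KontsevichZagierPeriods.StokesGenerationLine

/-! ## §4 The bridge: a `z₀`-only type-(a) certificate yields a real one-variable certificate -/

section Bridge

/-- The real Taylor series of `1/(2 + t) − 1/(3 − t)` on `[−1, 1]`. [folklore] -/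
theorem hasSum_witness_real {t : ℝ} (ht : |t| ≤ 1) :
    HasSum (fun n : ℕ => ((1 / 2 : ℝ) * (-1 / 2) ^ n - (1 / 3) * (1 / 3) ^ n) * t ^ n)
      (1 / (2 + t) - 1 / (3 - t)) := by
  have h1 : HasSum (fun n : ℕ => (-t / 2) ^ n) (1 - (-t / 2))⁻¹ :=
    hasSum_geometric_of_abs_lt_one (by rw [abs_div, abs_neg]; norm_num; linarith)
  have h2 : HasSum (fun n : ℕ => (t / 3) ^ n) (1 - t / 3)⁻¹ :=
    hasSum_geometric_of_abs_lt_one (by rw [abs_div]; norm_num; linarith)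
  have h := (h1.mul_left (1 / 2)).sub (h2.mul_left (1 / 3))
  have ht1 : -1 ≤ t ∧ t ≤ 1 := abs_le.mp ht
  have e : (1 / 2 : ℝ) * (1 - -t / 2)⁻¹ - 1 / 3 * (1 - t / 3)⁻¹ = 1 / (2 + t) - 1 / (3 - t) := by
    rw [show (1 : ℝ) - -t / 2 = (2 + t) / 2 by ring, show (1 : ℝ) - t / 3 = (3 - t) / 3 by ring,
      inv_div, inv_div]
    ring
  rw [e] at h
  refine h.congr_fun fun n => ?_
  rw [show (-t / 2 : ℝ) = (-1 / 2) * t by ring, show (t / 3 : ℝ) = (1 / 3) * t by ring,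
    mul_pow, mul_pow]
  ring

/-- **The bridge.** If the witness `F` is a `ℚ`-combination of elements `∂₀G − G|_{z₀=1} + G|_{z₀=0}`
with `G ∈ 𝒪_{ℚ-alg}(𝔻̄^∞)` in the variable `z₀` only, then `1/(2 + t) − 1/(3 − t) + c` has a
`ℚ`-semialgebraic primitive on `[0, 1]` for some real `c`: the real parts of the `G`'s are
`ℚ`-semialgebraic `C¹` germs on a box around the closed cube (`generator_package`), the complex
identity evaluates on the cube (`cube_identity`), and along the edge `t ↦ (t, 0, …, 0)` the
type-(a) expression is `g' (t) − g(1) + g(0)`. [cite: Ayoub2014, Def. 10 and Rem. 13] -/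
theorem exists_semialgebraic_primitive_of_mem_kSpan {F : CSeries}
    (hFc : ∀ n : ℕ, MvPowerSeries.coeff (single 0 n) F =
      (((1 / 2 : ℝ) * (-1 / 2) ^ n - (1 / 3) * (1 / 3) ^ n : ℝ) : ℂ))
    (hFz : ∀ b : ℕ →₀ ℕ, (∀ n, b ≠ single 0 n) → MvPowerSeries.coeff b F = 0)
    (hspan : F ∈ kSpan (algebraMap ℚ ℂ)
      {x : CSeries | ∃ G ∈ Oan (algebraMap ℚ ℂ), DependsOnlyOnLT G 1 ∧ x = relAC 0 G}) :
    ∃ (c : ℝ) (g : (Fin 1 → ℝ) → ℝ),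
      IsSemialgebraicFunOn ℚ {x | x 0 ∈ Icc (0 : ℝ) 1} g ∧
      ∀ t ∈ Ioo (0 : ℝ) 1,
        HasDerivAt (fun s : ℝ => g (fun _ => s)) (1 / (2 + t) - 1 / (3 - t) + c) t := by
  classical
  obtain ⟨J, lam, s, hs, hF⟩ := hspan
  choose G hG hG1 hsG using hs
  -- `Kⱼ = λⱼ Gⱼ ∈ 𝒪_{ℚ-alg}(𝔻̄^∞)`, in the variable `z₀`
  have hlam : ∀ j, ∃ p : Polynomial ℚ, p ≠ 0 ∧
      Polynomial.eval₂ (algebraMap ℚ ℂ) (algebraMap ℚ ℂ (lam j)) p = 0 := fun j =>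
    ⟨Polynomial.X - Polynomial.C (lam j), Polynomial.X_sub_C_ne_zero _, by simp⟩
  have hK : ∀ j, (algebraMap ℚ ℂ (lam j)) • G j ∈ Oan (algebraMap ℚ ℂ) := fun j =>
    smul_mem_Oan _ (hlam j) (hG j)
  have hK1 : ∀ j, DependsOnlyOnLT ((algebraMap ℚ ℂ (lam j)) • G j) 1 := fun j a ha => by
    rw [MvPowerSeries.coeff_smul, hG1 j a ha, mul_zero]
  choose r hr1 hrs using fun j => (hK j).2.1
  choose P hP0 hPK using fun j => (hK j).2.2
  choose V hV using fun j => exists_vars_subset_range (P j)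
  -- the dimension `M ≥ 1`, past the variables of the `Pⱼ`
  obtain ⟨M, h1M, hVM⟩ : ∃ M, 1 ≤ M ∧ ∀ j, V j ≤ M := by
    refine ⟨1 + ∑ j, V j, Nat.le_add_right _ _, fun j => ?_⟩
    have hle : V j ≤ ∑ j', V j' :=
      Finset.single_le_sum (f := fun j' => V j') (fun _ _ => Nat.zero_le _) (Finset.mem_univ j)
    omega
  have hKd : ∀ j, DependsOnlyOnLT ((algebraMap ℚ ℂ (lam j)) • G j) M := fun j => (hK1 j).mono h1M
  have hvars : ∀ j n, (↑((P j).coeff n).vars : Set ℕ) ⊆ Set.range (Fin.val : Fin M → ℕ) :=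
    fun j n => hV j M (hVM j) n
  -- one package per generator
  choose ρ hρ1 hρr hsemi hC1 hderiv using
    fun j => generator_package (hr1 j) (hrs j) (hKd j) (hP0 j) (hPK j) (hvars j)
  set i0 : Fin M := ⟨0, h1M⟩ with hi0
  set gfun : Fin J → (Fin M → ℝ) → ℝ := fun j y => ∑' a : Fin M →₀ ℕ,
    (MvPowerSeries.coeff (Finsupp.embDomain Fin.valEmbedding a)
      ((algebraMap ℚ ℂ (lam j)) • G j)).re * ∏ l, y l ^ a l with hgfun
  have hWo : ∀ j, IsOpen (Set.pi Set.univ (fun _ : Fin M => Set.Ioo (-(ρ j : ℝ)) (ρ j))) :=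
    fun j => isOpen_box _
  have hcubeW : ∀ j, Set.pi Set.univ (fun _ : Fin M => Set.Icc (0:ℝ) 1) ⊆
      Set.pi Set.univ (fun _ : Fin M => Set.Ioo (-(ρ j : ℝ)) (ρ j)) := fun j => cubePi_subset_box (hρ1 j)
  -- the edge `t ↦ (t, 0, …, 0)` of the closed cube
  have hedge : ∀ t ∈ Icc (0:ℝ) 1,
      (Pi.single i0 t : Fin M → ℝ) ∈ Set.pi Set.univ (fun _ : Fin M => Set.Icc (0:ℝ) 1) := by
    intro t ht l _
    rcases eq_or_ne l i0 with rfl | hl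
    · rw [Pi.single_eq_same]; exact ht
    · rw [Pi.single_eq_of_ne hl]; exact ⟨le_rfl, zero_le_one⟩
  -- the complex identity, read on the edge
  have hNM : 1 ≤ M := h1M
  have hHas : ∀ x ∈ Set.pi Set.univ (fun _ : Fin 1 => Set.Icc (0:ℝ) 1),
      HasSum (fun a : Fin 1 →₀ ℕ =>
        ((1 / 2 : ℝ) * (-1 / 2) ^ (a 0) - (1 / 3) * (1 / 3) ^ (a 0)) * ∏ j, x j ^ a j)
        (1 / (2 + x 0) - 1 / (3 - x 0)) := by
    intro x hx
    have hx0 : |x 0| ≤ 1 := by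
      have h := hx 0 (mem_univ _)
      exact abs_le.mpr ⟨by linarith [h.1], h.2⟩
    let e : ℕ ≃ (Fin 1 →₀ ℕ) :=
      { toFun := fun n => single 0 n
        invFun := fun a => a 0
        left_inv := fun n => single_eq_same
        right_inv := fun a => Finsupp.ext fun i => by rw [Subsingleton.elim i 0, single_eq_same] }
    refine (e.hasSum_iff).mp ?_
    refine (hasSum_witness_real hx0).congr_fun fun n => ?_
    simp [e]
  have hFc' : ∀ a : Fin 1 →₀ ℕ, MvPowerSeries.coeff (a.embDomain Fin.valEmbedding) F =
      (((1 / 2 : ℝ) * (-1 / 2) ^ (a 0) - (1 / 3) * (1 / 3) ^ (a 0) : ℝ) : ℂ) := by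
    intro a
    have ha : a = single 0 (a 0) := Finsupp.ext fun i => by rw [Subsingleton.elim i 0, single_eq_same]
    conv_lhs => rw [ha, embDomain_single]
    exact hFc (a 0)
  have hFz' : ∀ b : ℕ →₀ ℕ, b ∉ Set.range (Finsupp.embDomain (@Fin.valEmbedding 1)) →
      MvPowerSeries.coeff b F = 0 := by
    intro b hb
    refine hFz b fun n hn => hb ⟨single 0 n, ?_⟩
    rw [embDomain_single, hn]
    rfl
  have hF' : F = ∑ j, relAC ((fun _ : Fin J => i0) j : ℕ) ((algebraMap ℚ ℂ (lam j)) • G j) := by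
    rw [hF]
    exact Finset.sum_congr rfl fun j _ => by rw [hsG j, relAC_smul]
  have hid : ∀ t ∈ Icc (0:ℝ) 1, 1 / (2 + t) - 1 / (3 - t) =
      ∑ j, (fderiv ℝ (gfun j) (Pi.single i0 t) (Pi.single i0 1) -
        gfun j (Pi.single i0 1) + gfun j 0) := by
    intro t ht
    have h := cube_identity (M := M) hNM (h := fun x => 1 / (2 + x 0) - 1 / (3 - x 0)) hHas hFc' hFz'
      _ (fun _ => i0) hF' r hr1 hrs hKd (Pi.single i0 t) (hedge t ht)
    have h0 : (Pi.single i0 t : Fin M → ℝ) (Fin.castLE hNM 0) = t := by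
      have : Fin.castLE hNM 0 = i0 := Fin.ext rfl
      rw [this, Pi.single_eq_same]
    simp only [h0] at h
    rw [h]
    refine Finset.sum_congr rfl fun j _ => ?_
    rw [hderiv j _ (hcubeW j (hedge t ht)) i0]
    have hu1 : Function.update (Pi.single i0 t : Fin M → ℝ) i0 1 = Pi.single i0 1 := by
      rw [Pi.single, Function.update_idem]; rfl
    have hu0 : Function.update (Pi.single i0 t : Fin M → ℝ) i0 0 = 0 := by
      rw [Pi.single, Function.update_idem, ← Pi.single, Pi.single_zero]
    simp only [hgfun, hu1, hu0]
  -- the real certificate `g(t) = Σⱼ gⱼ(t, 0, …, 0)`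
  refine ⟨∑ j, (gfun j (Pi.single i0 1) - gfun j 0),
    fun x => ∑ j, gfun j (Pi.single i0 (x 0)), ?_, ?_⟩
  · -- semialgebraicity on `[0, 1]`
    have hS : Literature.ModelTheory.ExponentialFields.IsSemialgebraic ℚ
        {x : Fin 1 → ℝ | x 0 ∈ Icc (0 : ℝ) 1} := by
      have : {x : Fin 1 → ℝ | x 0 ∈ Icc (0 : ℝ) 1} =
          Set.pi Set.univ (fun _ : Fin 1 => Set.Icc (0:ℝ) 1) := by
        ext x; simp only [Set.mem_setOf_eq, Set.mem_univ_pi, Fin.forall_fin_one]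
      rw [this]; exact isSemialgebraic_cubePi 1
    have hφ : IsSemialgebraicMapOn ℚ {x : Fin 1 → ℝ | x 0 ∈ Icc (0 : ℝ) 1}
        (fun x => (Pi.single i0 (x 0) : Fin M → ℝ)) := by
      refine (isSemialgebraicMapOn_aeval hS
        (Pi.single i0 (MvPolynomial.X 0 : MvPolynomial (Fin 1) ℚ))).congr fun x _ => ?_
      funext l
      rcases eq_or_ne l i0 with rfl | hl
      · simp
      · simp [Pi.single_eq_of_ne hl]
    have hmaps : ∀ j, MapsTo (fun x : Fin 1 → ℝ => (Pi.single i0 (x 0) : Fin M → ℝ))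
        {x : Fin 1 → ℝ | x 0 ∈ Icc (0 : ℝ) 1}
        (Set.pi Set.univ (fun _ : Fin M => Set.Ioo (-(ρ j : ℝ)) (ρ j))) :=
      fun j x hx => hcubeW j (hedge (x 0) hx)
    refine KZ.isSemialgebraicFunOn_finset_sum Finset.univ hS fun j _ => ?_
    exact IsSemialgebraicFunOn.comp_isSemialgebraicMapOn_holds (hsemi j) hφ (hmaps j)
  · -- the derivative along the edge
    intro t ht
    have htI : t ∈ Icc (0:ℝ) 1 := Ioo_subset_Icc_self ht
    have hpath : HasDerivAt (fun s : ℝ => (Pi.single i0 s : Fin M → ℝ))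
        (Pi.single i0 (1 : ℝ) : Fin M → ℝ) t := by
      have h := (hasDerivAt_id t).smul_const (Pi.single i0 (1 : ℝ) : Fin M → ℝ)
      simp only [one_smul] at h
      refine h.congr_of_eventuallyEq (Filter.Eventually.of_forall fun s => ?_)
      show (Pi.single i0 s : Fin M → ℝ) = id s • (Pi.single i0 (1 : ℝ) : Fin M → ℝ)
      funext l
      rcases eq_or_ne l i0 with rfl | hl
      · simp
      · simp [Pi.single_eq_of_ne hl]
    have hj : ∀ j ∈ (Finset.univ : Finset (Fin J)),
        HasDerivAt (fun s : ℝ => gfun j (Pi.single i0 s))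
          (fderiv ℝ (gfun j) (Pi.single i0 t) (Pi.single i0 1)) t := by
      intro j _
      have hx : (Pi.single i0 t : Fin M → ℝ) ∈
          Set.pi Set.univ (fun _ : Fin M => Set.Ioo (-(ρ j : ℝ)) (ρ j)) := hcubeW j (hedge t htI)
      have hdiff : DifferentiableAt ℝ (gfun j) (Pi.single i0 t) :=
        ((hC1 j).differentiableOn one_ne_zero _ hx).differentiableAt ((hWo j).mem_nhds hx)
      exact hdiff.hasFDerivAt.comp_hasDerivAt t hpath
    have hsum := HasDerivAt.fun_sum hj
    refine hsum.congr_deriv ?_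
    have h := hid t htI
    rw [Finset.sum_add_distrib, Finset.sum_sub_distrib] at h
    rw [Finset.sum_sub_distrib]
    linarith

end Bridge

/-! ## §5 The negative lemma -/

open Polynomial in
/-- **No `ℚ`-semialgebraic primitive of `1/(2 + t) − 1/(3 − t) + c` on `[0, 1]`**, for any real `c`:
the simple pole at `t = 3` (`((X − 3)(X + 2))·(f + c) = 2X − 1 + c (X − 3)(X + 2)`, value `5 ≠ 0` at
`3`) obstructs every polynomial relation `P(t, g(t)) = 0` of a primitive `g` (barrier file's
descent `NoSemialgPrimKernel.eq_zero_of_evalEval_eq_zero`), while a semialgebraic `g` has one.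
[cite: Ayoub2015, Rem. 1.2] -/
theorem no_semialgebraic_primitive (c : ℝ) (g : (Fin 1 → ℝ) → ℝ)
    (hg : IsSemialgebraicFunOn ℚ {x | x 0 ∈ Icc (0 : ℝ) 1} g)
    (hd : ∀ t ∈ Ioo (0 : ℝ) 1,
      HasDerivAt (fun s : ℝ => g (fun _ => s)) (1 / (2 + t) - 1 / (3 - t) + c) t) : False := by
  obtain ⟨P, hP0, hPv⟩ :=
    Literature.Barriers.KontsevichZagierPeriods.KZ.NoSemialgPrimKernel.exists_ne_zero_evalEval_eq_zero hg
  have hV : (X + C (2 : ℝ) : ℝ[X]).eval 3 ≠ 0 := by norm_num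
  have hN : (C (2 : ℝ) * X - C 1 + C c * (X - C 3) * (X + C 2) : ℝ[X]).eval 3 ≠ 0 := by norm_num
  have hDN : ∀ t ∈ Ioo (0 : ℝ) 1,
      ((X - C (3 : ℝ)) * (X + C 2)).eval t * (1 / (2 + t) - 1 / (3 - t) + c)
        = (C (2 : ℝ) * X - C 1 + C c * (X - C 3) * (X + C 2) : ℝ[X]).eval t := by
    intro t ht
    have h2 : (2 : ℝ) + t ≠ 0 := by have := ht.1; intro h; linarith
    have h3 : (3 : ℝ) - t ≠ 0 := by have := ht.2; intro h; linarith
    simp only [eval_mul, eval_add, eval_sub, eval_X, eval_C]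
    field_simp
    ring
  exact hP0 (Literature.Barriers.KontsevichZagierPeriods.KZ.NoSemialgPrimKernel.eq_zero_of_evalEval_eq_zero
    (G := fun s : ℝ => g fun _ => s) hd hDN hV hN P.natDegree P le_rfl
    (fun t ht => hPv t (Ioo_subset_Icc_self ht)))

/-- **Certificates in the SAME variables as `F` do not suffice (Ayoub-typed; level one of the
variable count).** It is FALSE that every one-variable kernel element `F ∈ 𝒪_{k-alg}(𝔻̄^∞)`
(`F` in `z₀` only, `∫ F = 0`) is a `k`-combination of type-(a) elements
`∂G/∂zᵢ − G|_{zᵢ=1} + G|_{zᵢ=0}` with `G ∈ 𝒪_{k-alg}(𝔻̄^∞)` ALSO in `z₀` only: the witness is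
`k = ℚ`, `F = 1/(2 + z₀) − 1/(3 − z₀)` (the reflection relation). Any proof of the crux
`TypeAGeneration` must therefore use auxiliary variables already for this `F`; two suffice in print.
[cite: Ayoub2015, Rem. 1.2 and Rem. 1.5] [cite: Fresan2024, Rem. 3.6–3.7] -/
theorem typeAGeneration_false_sameVariables :
    ¬ (∀ (k : Type) [Field k] [CharZero k] (σ : k →+* ℂ), (∀ c : k, IsAlgebraic ℚ (σ c)) →
        ∀ F ∈ Oan σ, DependsOnlyOnLT F 1 → intC F = 0 →
          F ∈ kSpan σ {x : CSeries | ∃ G ∈ Oan σ, DependsOnlyOnLT G 1 ∧ ∃ i : ℕ, x = relAC i G}) := by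
  classical
  intro h
  obtain ⟨F, hFO, hF1, hF0, hFc, hFz⟩ := exists_witness
  obtain ⟨n, cc, s, hs, hFsum⟩ :=
    h ℚ (algebraMap ℚ ℂ) (fun c => isAlgebraic_algebraMap c) F hFO hF1 hF0
  choose G hG hG1 i hsi using hs
  -- directions `i ≥ 1` contribute `0`: replace `Gⱼ` by `0` there
  have key : F ∈ kSpan (algebraMap ℚ ℂ)
      {x : CSeries | ∃ G ∈ Oan (algebraMap ℚ ℂ), DependsOnlyOnLT G 1 ∧ x = relAC 0 G} := by
    refine ⟨n, cc, s, fun j => ⟨if i j = 0 then G j else 0, ?_, ?_, ?_⟩, hFsum⟩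
    · split_ifs
      · exact hG j
      · exact zero_mem_Oan _
    · split_ifs
      · exact hG1 j
      · intro a _; exact map_zero _
    · by_cases hij : i j = 0
      · rw [if_pos hij, hsi j, hij]
      · rw [if_neg hij, relAC_zero, hsi j]
        exact relAC_eq_zero_of_dependsOnlyOnLT_one (hG1 j) (Nat.one_le_iff_ne_zero.mpr hij)
  obtain ⟨c, g, hg, hd⟩ := exists_semialgebraic_primitive_of_mem_kSpan hFc hFz key
  exact no_semialgebraic_primitive c g hg hd

end Summit.KontsevichZagierPeriods.SymplecticScissors.TypeAGenerationNegative
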